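import Literature.NumberTheory.GaloisRepresentations.WeilDeligneOfGalois
import Literature.NumberTheory.GaloisRepresentations.WeilGroupFrobeniusPowers
import Literature.NumberTheory.GaloisRepresentations.LocalGaloisGroupFrobeniusProofs
import Literature.LinearAlgebra.Matrix.NilpotentExpInjective
import Literature.Algebra.Polynomial.QDilationCongruence
import Mathlib.LinearAlgebra.Charpoly.Basic
import Mathlib.FieldTheory.Minpoly.Basic
import HarnessLib

/-!
# Independence of choices in the Grothendieck–Deligne dictionary: discharge of
# `IsWeilDeligneOfLadic.isEquivalent` (Deligne, Antwerp II, §8.4.2)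

D-0014 keeps `Literature/` sorry-free by stating cited results as named facts `def X : Prop`.
This sibling file of `Literature.NumberTheory.GaloisRepresentations.WeilDeligneOfGalois` proves
the named fact **`IsWeilDeligneOfLadic.isEquivalent`**: if `r = (ρ, N)` and `r' = (ρ', N')` are
Weil–Deligne representations on `Fin n → E` both attached to the same `ρW : W_F →* GL_n(E)` by
the Grothendieck–Deligne recipe `IsWeilDeligneOfLadic` — for possibly different tame characters
`t, t'`, open subgroups `U, U'` of inertia and geometric Frobenii `Φ, Φ'` — then `r ≅ r'`
(`theorem IsWeilDeligneOfLadic.isEquivalent_holds`). Users holding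
`(h : IsWeilDeligneOfLadic.isEquivalent)` are fed this theorem.

On the way it proves the classical rescaling lemma
`WeilDeligneRep.exists_linearEquiv_comp_N_eq_smul`: **`(ρ, N) ≅ (ρ, λ N)` for every `λ ≠ 0`**,
for any Weil–Deligne representation on a finite-dimensional space over a field of characteristic
zero (this is why the class of `WD(ρ_λ)` does not depend on the isomorphism `ℚ_ℓ(1) ≃ ℚ_ℓ`
normalising `t_ℓ`, Deligne 1973, 8.4.2).

## The proof (Deligne 1973, §8.4.2; Tate 1979, (4.2.1)), arranged for the relation as vendored

Write `P = ρW`, `R(w) = [r.ρ w]`, `R'(w) = [r'.ρ w]` (matrices), `N, N'` for the matrices of the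
monodromies; the hypotheses are `P(u) = exp(t(u) N)` on `U`, `R(Φ^m u) = P(Φ^m u) exp(-t(u) N)` for
`u ∈ I_F`, `t` non-trivial on `U`, and the same with primes.

1. **Powers** (`WeilGroup.exists_pow_mem_of_isOpen`, compactness of `I_F`): every `u ∈ I_F` has a
   power `u^k ∈ U ∩ U'`, `k ≥ 1`.
2. **Uniqueness of the logarithm** (`Literature.LinearAlgebra.Matrix.eq_of_exp_eq_exp`): on
   `U ∩ U'`, `exp(t(u) N) = P(u) = exp(t'(u) N')` gives `t(u) N = t'(u) N'`; by 1 and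
   `t(u^k) = k t(u)` (characteristic `0`) this holds for **all** `u ∈ I_F`. Hence `R = R'` on
   `I_F` (take `m = 0`), and `N' = c N` with `c ≠ 0` (evaluate at `u₀` with `t(u₀) ≠ 0`; if `N = 0`,
   non-triviality of `t'` forces `N' = 0` and `c = 1`).
3. **Change of Frobenius**: `v = Φ'⁻¹ Φ ∈ I_F` and `R'(Φ) = P(Φ) exp(-t'(v) N') = R(Φ) exp(-s N)`,
   `s = t(v)`. With `a = s / (1 - q)` the unipotent `B = exp(a N)` satisfies `B R(w) B⁻¹ = R'(w)`:
   on `I_F` because `R(u)` commutes with `N` (`deg u = 0`), at `Φ` because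
   `N R(Φ) = q R(Φ) N` (`deg Φ = -1`) gives `exp(aN) R(Φ) = R(Φ) exp(aqN)` and `aq = a - s`; hence
   everywhere (`WeilGroup.intertwines_of_inertia_of_frob`). `B` commutes with `N`.
4. **Rescaling** (`exists_linearEquiv_comp_N_eq_smul`, from
   `Literature.Algebra.Polynomial.exists_isCoprime_dvd_sub_C_mul_comp`): there is `A₂` commuting
   with `R(W_F)` and with `A₂ N = c N A₂`. Indeed let `ψ = R(Φ^k)` with `k ≥ 1` such that `ψ` is
   central in `R(W_F)` (`WeilGroup.exists_pow_commute_of_isOpen_ker`); then `N ψ = Q ψ N` with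
   `Q = q^k` not a root of unity, the minimal polynomial `χ` of the invertible `ψ` has `χ(0) ≠ 0`,
   and for `F` coprime to `χ` with `χ ∣ F - c F(QX)` the operator `A₂ = F(ψ)` is invertible
   (Bézout), commutes with the commutant of `ψ`, and `A₂ N = F(ψ) N = c F(Qψ) N = c N F(ψ)`.
5. `T = B A₂` is the isomorphism: `T R(w) = R'(w) T` and `T N = B A₂ N = c B N A₂ = c N B A₂ = N' T`.

## Mathlib / tree

`Representation.Equiv.mk`, `LinearEquiv.ofLinear`, `Matrix.toLin'`, `LinearMap.toMatrix'`
(`toMatrix'_comp`, `toMatrix'_toLin'`, `toMatrixAlgEquiv'`), `minpoly`,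
`LinearMap.minpoly_coeff_zero_of_injective`, `IsNilpotent.exp_add_of_commute`,
`IsNilpotent.exp_mul_exp_neg_self`. Discharged facts used: `IsFrobPow.mul_holds`,
`IsFrobPow.unique_holds`, `exists_isFrobPow_holds`, `absInertia_normal_holds`,
`WeilGroup.isCompact_inertia_holds`, `WeilGroup.isTopologicalGroup_holds`. No new definitions, no
new named facts.

## References

* P. Deligne, *Les constantes des équations fonctionnelles des fonctions `L`*, Antwerp II,
  LNM 349 (1973), §8.4.2. [DeligneAntwerpII1973]
* J. Tate, *Number theoretic background*, Corvallis 1979, (4.1.2)–(4.2.1). [TateCorvallis1979]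
-/

noncomputable section

open Polynomial

namespace Literature.NumberTheory.GaloisRepresentations

variable {F : Type*} [Field F] [ValuativeRel F] [TopologicalSpace F] [IsNonarchimedeanLocalField F]

/-! ### Rescaling the monodromy operator: `(ρ, N) ≅ (ρ, λ N)` -/

namespace WeilDeligneRep

variable {E : Type*} [Field E] [CharZero E] {V : Type*} [AddCommGroup V] [Module E V]
  [FiniteDimensional E V]

open GaloisRepresentations.IsNonarchimedeanLocalField WeilGroup

omit [CharZero E] in
/-- If `x` commutes with `ψ` then it commutes with every polynomial in `ψ`. [folklore] -/
theorem commute_aeval_of_commute {A : Type*} [Ring A] [Algebra E A] {x ψ : A}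
    (h : Commute x ψ) (G : E[X]) : Commute x (aeval ψ G) := by
  induction G using Polynomial.induction_on' with
  | add p q hp hq => rw [map_add]; exact hp.add_right hq
  | monomial n a =>
    rw [aeval_monomial, ← Algebra.smul_def]
    exact (h.pow_right n).smul_right a

omit [CharZero E] in
/-- If `N ψ = ψ' N` then `N G(ψ) = G(ψ') N` for every polynomial `G`. [folklore] -/
theorem mul_aeval_of_mul_eq {A : Type*} [Ring A] [Algebra E A] {N ψ ψ' : A}
    (h : N * ψ = ψ' * N) (G : E[X]) : N * aeval ψ G = aeval ψ' G * N := by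
  induction G using Polynomial.induction_on' with
  | add p q hp hq => rw [map_add, map_add, mul_add, add_mul, hp, hq]
  | monomial n a =>
    rw [aeval_monomial, aeval_monomial, ← Algebra.smul_def, ← Algebra.smul_def, mul_smul_comm,
      smul_mul_assoc, (SemiconjBy.pow_right h n).eq]

/-- `(q : E) ^ m ≠ 1` for `m ≥ 1`: the residue cardinality `q ≥ 2` is not a root of unity in a
field of characteristic zero. [folklore] -/
theorem residueFieldCard_pow_ne_one {m : ℕ} (hm : 0 < m) :
    ((residueFieldCard F : E)) ^ m ≠ 1 := by
  intro h
  have h1 : ((residueFieldCard F ^ m : ℕ) : E) = ((1 : ℕ) : E) := by simpa using h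
  have h2 : residueFieldCard F ^ m = 1 := Nat.cast_injective h1
  have h3 := one_lt_residueFieldCard F
  have : residueFieldCard F ^ m ≥ residueFieldCard F ^ 1 := Nat.pow_le_pow_right (by omega) hm
  rw [pow_one, h2] at this
  omega

/-- **Rescaling the monodromy: `(ρ, N) ≅ (ρ, λ N)`.** For a Weil–Deligne representation
`(ρ, N)` on a finite-dimensional space over a field of characteristic zero and `λ ≠ 0` there is
an automorphism `A` of `V` commuting with `ρ(W_F)` and satisfying `A N = λ N A`. The automorphism
is a polynomial `F(ψ)` in `ψ = ρ(Φ^k)`, `Φ` a geometric Frobenius and `k ≥ 1` with `ρ(Φ^k)`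
central in `ρ(W_F)` (`WeilGroup.exists_pow_commute_of_isOpen_ker`), where `F` is coprime to the
minimal polynomial `χ` of `ψ` and `χ ∣ F(X) - λ F(q^k X)`
(`Literature.Algebra.Polynomial.exists_isCoprime_dvd_sub_C_mul_comp`, using `N ψ = q^k ψ N`). This
is the reason the isomorphism class of `WD(ρ_λ)` does not depend on the normalisation of the
`ℓ`-adic tame character. [cite: DeligneAntwerpII1973, §8.4.2] -/
theorem exists_linearEquiv_comp_N_eq_smul (r : WeilDeligneRep F E V) {l : E} (hl : l ≠ 0) :
    ∃ A : V ≃ₗ[E] V, (∀ w, (A : V →ₗ[E] V) ∘ₗ r.ρ w = r.ρ w ∘ₗ (A : V →ₗ[E] V)) ∧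
      (A : V →ₗ[E] V) ∘ₗ r.N = l • (r.N ∘ₗ (A : V →ₗ[E] V)) := by
  classical
  have hmul : IsFrobPow.mul (F := F) := IsFrobPow.mul_holds
  have huniq : IsFrobPow.unique (F := F) := IsFrobPow.unique_holds
  -- a geometric Frobenius and a central power of it
  obtain ⟨Φ, hΦ⟩ := deg_surjective hmul huniq (exists_isFrobPow_holds F) (-1 : ℤ)
  obtain ⟨U, -, hUo, hU⟩ := r.isContinuous
  obtain ⟨k, hk, hcomm⟩ := exists_pow_commute_of_isOpen_ker r.ρ U hUo hU Φ
  set ψ : Module.End E V := r.ρ (Φ ^ k) with hψ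
  have hψcomm : ∀ w, ψ * r.ρ w = r.ρ w * ψ := by
    intro w
    refine intertwines_of_inertia_of_frob r.ρ r.ρ ψ hΦ ?_ (fun u hu => (hcomm u hu).eq) w
    rw [hψ, map_pow]
    exact (Commute.pow_left (Commute.refl _) k).eq
  -- `N ψ = Q ψ N` with `Q = q ^ k`
  set Q : E := (residueFieldCard F : E) ^ k with hQ
  have hQ0 : Q ≠ 0 := pow_ne_zero _ (by exact_mod_cast residueFieldCard_ne_zero F)
  have hQ1 : ∀ e : ℕ, 0 < e → Q ^ e ≠ 1 := fun e he => by
    rw [hQ, ← pow_mul]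
    exact residueFieldCard_pow_ne_one (Nat.mul_pos hk he)
  have hNψ : r.N * ψ = (Q • ψ) * r.N := by
    have h := r.conj_N (Φ ^ k)
    rw [deg_pow, hΦ, mul_neg_one, ← hψ] at h
    change ψ * r.N = ((residueFieldCard F : E) ^ (-(k : ℤ))) • (r.N * ψ) at h
    have hq : (residueFieldCard F : E) ^ (-(k : ℤ)) = Q⁻¹ := by
      rw [zpow_neg, zpow_natCast]
    have h2 : Q • (ψ * r.N) = r.N * ψ := by
      rw [h, hq, smul_smul, mul_inv_cancel₀ hQ0, one_smul]
    rw [smul_mul_assoc, h2]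
  -- the minimal polynomial of `ψ` has non-zero constant term (`ψ` is invertible)
  have hψunit : r.ρ (Φ ^ k)⁻¹ * ψ = 1 := by rw [hψ, ← map_mul, inv_mul_cancel, map_one]
  have hψinj : Function.Injective ψ := by
    intro x y hxy
    have := congrArg (r.ρ (Φ ^ k)⁻¹) hxy
    rwa [← Module.End.mul_apply, ← Module.End.mul_apply, hψunit, Module.End.one_apply,
      Module.End.one_apply] at this
  have hχ0 : (minpoly E ψ).coeff 0 ≠ 0 := LinearMap.minpoly_coeff_zero_of_injective hψinj
  -- the rescaling polynomial `G`: coprime to `minpoly ψ`, `minpoly ψ ∣ G(X) - l G(Q X)`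
  obtain ⟨G, ⟨a, b, hab⟩, ⟨g, hg⟩⟩ :=
    Literature.Algebra.Polynomial.exists_isCoprime_dvd_sub_C_mul_comp hQ0 hQ1 hχ0 hl
  set A : Module.End E V := aeval ψ G with hA
  set B : Module.End E V := aeval ψ a with hB
  have hBA : B * A = 1 := by
    have h := congrArg (aeval ψ) hab
    rwa [map_add, map_mul, map_mul, minpoly.aeval, mul_zero, add_zero, map_one] at h
  have hAB : A * B = 1 := by
    have hc : Commute B A :=
      commute_aeval_of_commute (commute_aeval_of_commute (Commute.refl ψ) a).symm G
    rw [← hc.eq]; exact hBA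
  -- `A = l • G(Q ψ)`
  have hAeq : A = l • aeval (Q • ψ) G := by
    have h := congrArg (aeval ψ) hg
    rw [map_mul, minpoly.aeval, zero_mul, map_sub, map_mul, aeval_C, aeval_comp,
      map_mul, aeval_C, aeval_X, sub_eq_zero, ← Algebra.smul_def, ← Algebra.smul_def] at h
    rw [hA, h]
  refine ⟨LinearEquiv.ofLinear A B hAB hBA, fun w => ?_, ?_⟩
  · change A * r.ρ w = r.ρ w * A
    have hc : Commute (r.ρ w) ψ := (hψcomm w).symm
    exact (commute_aeval_of_commute hc G).eq.symm
  · change A * r.N = l • (r.N * A)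
    rw [hA] at hAeq ⊢
    rw [mul_aeval_of_mul_eq hNψ G, hAeq, smul_mul_assoc]

end WeilDeligneRep

/-! ### The discharge -/

section Discharge

open GaloisRepresentations.IsNonarchimedeanLocalField WeilGroup

/-- **Independence of the choices `(t, U, Φ)` in the Grothendieck–Deligne recipe** — discharge
of the named fact `IsWeilDeligneOfLadic.isEquivalent`: two Weil–Deligne representations attached
to the same `ρW : W_F →* GL_n(E)` by `IsWeilDeligneOfLadic` (for tame characters `t, t'`, open
subgroups `U, U'`, geometric Frobenii `Φ, Φ'`) are isomorphic. Steps (module docstring):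
`t(u) N = t'(u) N'` on all of `I_F` by injectivity of `exp` on nilpotents and compactness of
`I_F`; `N' = c N`; conjugation by `exp (s/(1-q) · N)` moves `Φ` to `Φ'`; the rescaling lemma
`WeilDeligneRep.exists_linearEquiv_comp_N_eq_smul` moves `N` to `c N`.
[cite: DeligneAntwerpII1973, §8.4.2] -/
theorem IsWeilDeligneOfLadic.isEquivalent_holds : IsWeilDeligneOfLadic.isEquivalent := by
  intro F _ _ _ _ E _ _ n ρW r r' hr hr'
  obtain ⟨t, U, Φ, hU, hUo, hΦ, ⟨u₀, hu₀U, ht₀⟩, h2, h3⟩ := hr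
  obtain ⟨t', U', Φ', hU', hUo', hΦ', ⟨u₀', hu₀U', ht₀'⟩, h2', h3'⟩ := hr'
  classical
  have hmul : IsFrobPow.mul (F := F) := IsFrobPow.mul_holds
  have huniq : IsFrobPow.unique (F := F) := IsFrobPow.unique_holds
  have hq0 : (residueFieldCard F : E) ≠ 0 := by exact_mod_cast residueFieldCard_ne_zero F
  have hq1 : (1 : E) - (residueFieldCard F : E) ≠ 0 := by
    intro h
    have h1 : ((1 : ℕ) : E) = (residueFieldCard F : E) := by simpa [sub_eq_zero] using h
    have h2 := Nat.cast_injective h1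
    have h3 := one_lt_residueFieldCard F
    omega
  set N := LinearMap.toMatrix' r.N with hN
  set N' := LinearMap.toMatrix' r'.N with hN'
  have hNnil : IsNilpotent N := r.isNilpotent_N.map LinearMap.toMatrixAlgEquiv'
  have hN'nil : IsNilpotent N' := r'.isNilpotent_N.map LinearMap.toMatrixAlgEquiv'
  -- Step 1: every `u ∈ I_F` has a positive power in `U ∩ U'`
  have hpow : ∀ u : inertia F, ∃ k : ℕ, 0 < k ∧ (u : WeilGroup F) ^ k ∈ U ∧
      (u : WeilGroup F) ^ k ∈ U' := by
    intro u
    obtain ⟨k, hk, hmem⟩ := exists_pow_mem_of_isOpen (U ⊓ U') (hUo.inter hUo') u.2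
    exact ⟨k, hk, Subgroup.mem_inf.mp hmem⟩
  -- Step 2: on `U ∩ U'`, `t(u) N = t'(u) N'` (injectivity of `exp` on nilpotents)
  have hB : ∀ u : inertia F, (u : WeilGroup F) ∈ U → (u : WeilGroup F) ∈ U' →
      (t u).toAdd • N = (t' u).toAdd • N' := by
    intro u hu hu'
    apply Literature.LinearAlgebra.Matrix.eq_of_exp_eq_exp (hNnil.smul _) (hN'nil.smul _)
    rw [← h2 u hu, ← h2' u hu']
  -- Step 3: `t(u) N = t'(u) N'` for all `u ∈ I_F`
  have hC : ∀ u : inertia F, (t u).toAdd • N = (t' u).toAdd • N' := by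
    intro u
    obtain ⟨k, hk, hkU, hkU'⟩ := hpow u
    have h := hB (u ^ k) (by simpa using hkU) (by simpa using hkU')
    rw [map_pow t, map_pow t', toAdd_pow, toAdd_pow, smul_assoc, smul_assoc,
      ← Nat.cast_smul_eq_nsmul E k, ← Nat.cast_smul_eq_nsmul E k] at h
    exact smul_right_injective (Matrix (Fin n) (Fin n) E) (Nat.cast_ne_zero.mpr hk.ne') h
  -- Step 4: `r.ρ = r'.ρ` on `I_F`
  have hD : ∀ u : inertia F, LinearMap.toMatrix' (r.ρ u) = LinearMap.toMatrix' (r'.ρ u) := by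
    intro u
    have h := h3 0 u
    have h' := h3' 0 u
    rw [zpow_zero, one_mul] at h h'
    rw [h, h', hC u]
  -- Step 5: `N' = c • N` with `c ≠ 0`
  have ht₀a : (t u₀).toAdd ≠ 0 := fun h => ht₀ (by rw [← ofAdd_toAdd (t u₀), h, ofAdd_zero])
  have ht₀a' : (t' u₀').toAdd ≠ 0 := fun h =>
    ht₀' (by rw [← ofAdd_toAdd (t' u₀'), h, ofAdd_zero])
  obtain ⟨c, hc0, hcN⟩ : ∃ c : E, c ≠ 0 ∧ N' = c • N := by
    by_cases hN0 : N = 0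
    · refine ⟨1, one_ne_zero, ?_⟩
      have h := hC u₀'
      rw [hN0, smul_zero, eq_comm, smul_eq_zero] at h
      rw [h.resolve_left ht₀a', hN0, smul_zero]
    · have h := hC u₀
      have hb : (t' u₀).toAdd ≠ 0 := by
        intro hb
        rw [hb, zero_smul, smul_eq_zero] at h
        exact hN0 (h.resolve_left ht₀a)
      refine ⟨(t' u₀).toAdd⁻¹ * (t u₀).toAdd, mul_ne_zero (inv_ne_zero hb) ht₀a, ?_⟩
      rw [mul_smul, h, inv_smul_smul₀ hb]
  -- Step 6: `r.ρ Φ = ρW Φ` and `r'.ρ Φ = ρW Φ · exp (-s N)` with `s = t(Φ'⁻¹ Φ)`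
  have hv : Φ'⁻¹ * Φ ∈ inertia F := by
    rw [← deg_eq_zero_iff_mem_inertia hmul huniq, deg_mul hmul huniq, deg_inv hmul huniq, hΦ,
      hΦ']
    norm_num
  set v : inertia F := ⟨Φ'⁻¹ * Φ, hv⟩ with hvdef
  set s : E := (t v).toAdd with hs
  have hRΦ : LinearMap.toMatrix' (r.ρ Φ) = ((ρW Φ : GL (Fin n) E) : Matrix (Fin n) (Fin n) E) := by
    have h := h3 1 1
    rw [zpow_one, OneMemClass.coe_one, mul_one, map_one, toAdd_one, zero_smul, neg_zero,
      IsNilpotent.exp_zero, mul_one] at h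
    exact h
  have hR'Φ : LinearMap.toMatrix' (r'.ρ Φ) =
      ((ρW Φ : GL (Fin n) E) : Matrix (Fin n) (Fin n) E) * IsNilpotent.exp (-(s • N)) := by
    have h := h3' 1 v
    have hv' : Φ' ^ (1 : ℤ) * (v : WeilGroup F) = Φ := by
      rw [zpow_one]; exact mul_inv_cancel_left Φ' Φ
    rw [hv'] at h
    rw [h, ← hC v]
  -- the Weil–Deligne relations of `r` in matrix form
  have hWD : ∀ w, LinearMap.toMatrix' (r.ρ w) * N =
      ((residueFieldCard F : E) ^ deg w) • (N * LinearMap.toMatrix' (r.ρ w)) := by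
    intro w
    have h := congrArg LinearMap.toMatrix' (r.conj_N w)
    rwa [LinearMap.toMatrix'_comp, map_smul, LinearMap.toMatrix'_comp] at h
  have hIcomm : ∀ u ∈ inertia F,
      LinearMap.toMatrix' (r.ρ u) * N = N * LinearMap.toMatrix' (r.ρ u) := by
    intro u hu
    rw [hWD u, (deg_eq_zero_iff_mem_inertia hmul huniq).mpr hu, zpow_zero, one_smul]
  have hΦN : N * LinearMap.toMatrix' (r.ρ Φ) =
      (residueFieldCard F : E) • (LinearMap.toMatrix' (r.ρ Φ) * N) := by
    have h := hWD Φ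
    rw [hΦ, zpow_neg, zpow_one] at h
    rw [h, smul_smul, mul_inv_cancel₀ hq0, one_smul]
  -- Step 7: `B = exp (a N)`, `a = s / (1 - q)`, conjugates `r.ρ` into `r'.ρ`
  set a : E := s / (1 - (residueFieldCard F : E)) with ha
  set B : Matrix (Fin n) (Fin n) E := IsNilpotent.exp (a • N) with hBdef
  set B' : Matrix (Fin n) (Fin n) E := IsNilpotent.exp (-(a • N)) with hB'def
  have hBB' : B * B' = 1 := IsNilpotent.exp_mul_exp_neg_self (hNnil.smul a)
  have hB'B : B' * B = 1 := IsNilpotent.exp_neg_mul_exp_self (hNnil.smul a)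
  have hBN : B * N = N * B :=
    Literature.LinearAlgebra.Matrix.exp_mul_eq_mul_exp (hNnil.smul a) (hNnil.smul a)
      (by rw [smul_mul_assoc, mul_smul_comm])
  let Rm : WeilGroup F →* Matrix (Fin n) (Fin n) E :=
    (LinearMap.toMatrixAlgEquiv' :
      Module.End E (Fin n → E) ≃ₐ[E] Matrix (Fin n) (Fin n) E).toMonoidHom.comp r.ρ
  let Rm' : WeilGroup F →* Matrix (Fin n) (Fin n) E :=
    (LinearMap.toMatrixAlgEquiv' :
      Module.End E (Fin n → E) ≃ₐ[E] Matrix (Fin n) (Fin n) E).toMonoidHom.comp r'.ρ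
  have hRm : ∀ w, Rm w = LinearMap.toMatrix' (r.ρ w) := fun w => rfl
  have hRm' : ∀ w, Rm' w = LinearMap.toMatrix' (r'.ρ w) := fun w => rfl
  have hBΦ : B * Rm Φ = Rm' Φ * B := by
    rw [hRm, hRm']
    have h1 : (a • N) * LinearMap.toMatrix' (r.ρ Φ) =
        LinearMap.toMatrix' (r.ρ Φ) * ((a * residueFieldCard F) • N) := by
      rw [smul_mul_assoc, hΦN, smul_smul, mul_smul_comm]
    have key : a * (1 - (residueFieldCard F : E)) = s := by rw [ha]; exact div_mul_cancel₀ s hq1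
    have hexp : (a * (residueFieldCard F : E)) • N = -(s • N) + a • N := by
      rw [← neg_smul, ← add_smul]
      congr 1
      linear_combination -key
    have hcomm : Commute (-(s • N)) (a • N) :=
      (((Commute.refl N).smul_left s).smul_right a).neg_left
    rw [hBdef, Literature.LinearAlgebra.Matrix.exp_mul_eq_mul_exp (hNnil.smul a) (hNnil.smul _)
      h1, hR'Φ, hRΦ, mul_assoc, ← IsNilpotent.exp_add_of_commute hcomm (hNnil.smul s).neg
      (hNnil.smul a), hexp]
  have hBI : ∀ u ∈ inertia F, B * Rm u = Rm' u * B := by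
    intro u hu
    rw [hRm, hRm', ← hD ⟨u, hu⟩]
    exact Literature.LinearAlgebra.Matrix.exp_mul_eq_mul_exp (hNnil.smul a) (hNnil.smul a)
      (by rw [smul_mul_assoc, mul_smul_comm, hIcomm u hu])
  have hBall : ∀ w, B * LinearMap.toMatrix' (r.ρ w) = LinearMap.toMatrix' (r'.ρ w) * B :=
    fun w => intertwines_of_inertia_of_frob Rm Rm' B hΦ hBΦ hBI w
  -- Step 8: rescale the monodromy of `r` by `c`
  obtain ⟨A₂, hA₂ρ, hA₂N⟩ := r.exists_linearEquiv_comp_N_eq_smul hc0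
  set A₂m := LinearMap.toMatrix' (A₂ : (Fin n → E) →ₗ[E] (Fin n → E)) with hA₂m
  have hA₂ρm : ∀ w, A₂m * LinearMap.toMatrix' (r.ρ w) = LinearMap.toMatrix' (r.ρ w) * A₂m := by
    intro w
    have h := congrArg LinearMap.toMatrix' (hA₂ρ w)
    rwa [LinearMap.toMatrix'_comp, LinearMap.toMatrix'_comp] at h
  have hA₂Nm : A₂m * N = c • (N * A₂m) := by
    have h := congrArg LinearMap.toMatrix' hA₂N
    rwa [LinearMap.toMatrix'_comp, map_smul, LinearMap.toMatrix'_comp] at h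
  -- Step 9: the isomorphism `T = B ∘ A₂`
  let Bₗ : (Fin n → E) ≃ₗ[E] (Fin n → E) :=
    LinearEquiv.ofLinear (Matrix.toLin' B) (Matrix.toLin' B')
      (by rw [← Matrix.toLin'_mul, hBB', Matrix.toLin'_one])
      (by rw [← Matrix.toLin'_mul, hB'B, Matrix.toLin'_one])
  let T : (Fin n → E) ≃ₗ[E] (Fin n → E) := A₂.trans Bₗ
  have hTm : LinearMap.toMatrix' (T : (Fin n → E) →ₗ[E] (Fin n → E)) = B * A₂m := by
    have hT : (T : (Fin n → E) →ₗ[E] (Fin n → E)) =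
        (Matrix.toLin' B) ∘ₗ (A₂ : (Fin n → E) →ₗ[E] (Fin n → E)) := rfl
    rw [hT, LinearMap.toMatrix'_comp, LinearMap.toMatrix'_toLin']
  have hTρ : ∀ w, (T : (Fin n → E) →ₗ[E] (Fin n → E)) ∘ₗ r.ρ w =
      r'.ρ w ∘ₗ (T : (Fin n → E) →ₗ[E] (Fin n → E)) := by
    intro w
    apply LinearMap.toMatrix'.injective
    rw [LinearMap.toMatrix'_comp, LinearMap.toMatrix'_comp, hTm, mul_assoc, hA₂ρm w, ← mul_assoc,
      hBall w, mul_assoc]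
  have hTN : (T : (Fin n → E) →ₗ[E] (Fin n → E)) ∘ₗ r.N =
      r'.N ∘ₗ (T : (Fin n → E) →ₗ[E] (Fin n → E)) := by
    apply LinearMap.toMatrix'.injective
    rw [LinearMap.toMatrix'_comp, LinearMap.toMatrix'_comp, hTm, ← hN, ← hN', mul_assoc, hA₂Nm,
      mul_smul_comm, ← mul_assoc, hBN, hcN, smul_mul_assoc, mul_assoc]
  exact ⟨{ toRepEquiv := Representation.Equiv.mk T hTρ, comm_N := hTN }⟩

end Discharge

end Literature.NumberTheory.GaloisRepresentations

end
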